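import Literature.GroupTheory.CombinatorialGroupTheory.SurfaceGroupPushout
import Literature.GroupTheory.CombinatorialGroupTheory.BorderedSurfaceDiscrimination
import HarnessLib

/-!
# Surface groups are fully residually free (Baumslag)

Topic `Literature/GroupTheory/CombinatorialGroupTheory`; theorems only.  `S_n =
Literature.Topology.FourManifolds.SurfaceGroup n` (`n ≥ 2`), `F₂ = F⟨p, q⟩ = FreeGroup Bool`
(`p = of true`, `q = of false`), `z = [p, q]`.

* `surfaceGroup_discriminated` — **for every finite list of non-trivial elements of `S_n`
  (`n ≥ 2`) there is a homomorphism `S_n → F₂` killing none of them** (G. Baumslag, *On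
  generalised free products*, Math. Z. 78 (1962), Thm. 1 with §4: surface groups are residually
  free, indeed fully residually free).  Proof (with Baumslag's big powers property of `z` in
  `F₂`, `FreeGroupBigPowers.lean`): `S_n ≅
  F_{2n-2} *_{r_{n-1} = r₁⁻¹} F⟨a, b⟩` (`SurfaceGroupPushout.lean`); the first factor is
  discriminated by the maps `α` with `α(r_{n-1}) = z` (`BorderedSurfaceDiscrimination.lean`), the
  second embeds by `a ↦ q`, `b ↦ p` (so `r₁⁻¹ = [a,b]⁻¹ ↦ [p,q] = z`); the combination lemma
  (`AmalgamDiscrimination.lean`) glues them after a Dehn twist along the amalgamated `ℤ`.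
* `surfaceGroup_residuallyFree`, `surfaceGroup_exists_hom_mul_ne` — the cases of one element and
  of one commutator (the inputs of [IUTchI] Lem. 2.7 (i), (iii) for surface groups).

## References

* G. Baumslag, *On generalised free products*, Math. Z. 78 (1962), Prop. 1, Thm. 1, §4. [Baumslag1962]
* R. C. Lyndon, P. E. Schupp, *Combinatorial Group Theory*, Springer (1977); Classics in
  Mathematics (2001), Ch. I §7 (surface groups as amalgams). [LyndonSchupp2001]
-/

noncomputable section

namespace Literature.GroupTheory.CombinatorialGroupTheory

open Literature.Topology.FourManifolds Monoid Monoid.PushoutI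

/-- `z = [p, q]` in `F⟨p, q⟩ = FreeGroup Bool`. -/
local notation3 "𝔷" => (FreeGroup.of true * FreeGroup.of false * (FreeGroup.of true)⁻¹ *
  (FreeGroup.of false)⁻¹ : FreeGroup Bool)

/-- **Genus one, closed side**: `F⟨a₁, b₁⟩ → F⟨p, q⟩`, `a₁ ↦ q`, `b₁ ↦ p` is injective and sends
`r₁⁻¹ = [a₁, b₁]⁻¹` to `z = [p, q]`. [cite: Baumslag1962, §4] -/
theorem exists_hom_genus_one_inv (L : List (FreeGroup (surfaceGen 1))) (hL : ∀ x ∈ L, x ≠ 1) :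
    ∃ β : FreeGroup (surfaceGen 1) →* FreeGroup Bool,
      β (surfaceRelator 1)⁻¹ = 𝔷 ∧ ∀ x ∈ L, β x ≠ 1 := by
  let β : FreeGroup (surfaceGen 1) →* FreeGroup Bool := FreeGroup.lift fun x => FreeGroup.of x.2
  let δ : FreeGroup Bool →* FreeGroup (surfaceGen 1) := FreeGroup.lift fun b => FreeGroup.of (0, b)
  have hδβ : δ.comp β = MonoidHom.id _ := by
    refine FreeGroup.ext_hom _ _ fun x => ?_
    obtain ⟨i, b⟩ := x
    have hi : i = 0 := Subsingleton.elim _ _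
    subst hi
    simp [β, δ]
  refine ⟨β, ?_, fun x hx h => hL x hx ?_⟩
  · rw [map_inv, surfaceRelator_one]
    simp only [β, map_mul, map_inv, FreeGroup.lift_apply_of, genA, genB]
    group
  · have := congrArg δ h
    rwa [map_one, ← MonoidHom.comp_apply, hδβ, MonoidHom.id_apply] at this

variable {g h : ℕ}

/-- In each factor of `F_{2g} *_ℤ F_{2h}` an element outside the amalgamated `ℤ` does not commute
with its generator (malnormality, `surfaceAmalgam_malnormal`). [cite: Baumslag1962, §4] -/
theorem surfaceAmalgam_commutator_ne_one (hg : 1 ≤ g) (hh : 1 ≤ h) (b : Bool)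
    (x : SurfaceAmalgamFactor g h b) (hx : x ∉ (surfaceAmalgamHom g h b).range) :
    x * surfaceAmalgamHom g h b (Multiplicative.ofAdd 1) * x⁻¹ *
      (surfaceAmalgamHom g h b (Multiplicative.ofAdd 1))⁻¹ ≠ 1 := by
  intro hc
  rw [mul_inv_eq_one] at hc
  have h1 := surfaceAmalgam_malnormal hg hh b x hx (Multiplicative.ofAdd 1) (by
    rw [hc]
    exact ⟨_, rfl⟩)
  exact one_ne_zero (ofAdd_eq_one.1 h1)

/-- **`F_{2g} *_{r_g = r₁⁻¹} F⟨a, b⟩` is discriminated by `F₂`** (`g ≥ 1`).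
[cite: Baumslag1962, Thm. 1] -/
theorem surfaceAmalgam_discriminated
    (hg : 1 ≤ g) (S : List (SurfaceAmalgam g 1)) (hS : ∀ s ∈ S, s ≠ 1) :
    ∃ Ψ : SurfaceAmalgam g 1 →* FreeGroup Bool, ∀ s ∈ S, Ψ s ≠ 1 := by
  -- the families: `α(r_g) = z` on the first factor, `β(r₁⁻¹) = z` on the second
  let 𝓕 : ∀ b : Bool, (SurfaceAmalgamFactor g 1 b →* FreeGroup Bool) → Prop := fun b =>
    Bool.rec (motive := fun b => (SurfaceAmalgamFactor g 1 b →* FreeGroup Bool) → Prop)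
      (fun α => α (surfaceRelator g) = 𝔷) (fun β => β (surfaceRelator 1)⁻¹ = 𝔷) b
  have h𝓕 : ∀ b f, 𝓕 b f → f.comp (surfaceAmalgamHom g 1 b) = zpowersHom _ 𝔷 := by
    intro b f hf
    refine MonoidHom.ext_mint ?_
    rw [MonoidHom.comp_apply, surfaceAmalgamHom_apply, zpowersHom_apply, toAdd_ofAdd, zpow_one,
      zpow_one]
    cases b with
    | false => exact hf
    | true => exact hf
  have hdisc : ∀ (b : Bool) (L : List (SurfaceAmalgamFactor g 1 b)), (∀ x ∈ L, x ≠ 1) →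
      ∃ f, 𝓕 b f ∧ ∀ x ∈ L, f x ≠ 1 := by
    intro b L hL
    cases b with
    | false => exact freeGroup_surfaceGen_discriminated hg L hL
    | true => exact exists_hom_genus_one_inv L hL
  obtain ⟨f, -, hf, m, hΦ⟩ := Amalgam.exists_twistLift_forall_ne_one
    (surfaceAmalgamHom_injective hg le_rfl) 𝔷 commutator_pq_ne_one bigPowers_pq
    (surfaceAmalgam_commutator_ne_one hg le_rfl) 𝓕 h𝓕 hdisc S hS
  exact ⟨_, hΦ⟩

/-- **Surface groups are fully residually free** (Baumslag): for `n ≥ 2` and every finite list of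
non-trivial elements of `S_n` there is a homomorphism `S_n → F₂` killing none of them.
[cite: Baumslag1962, Thm. 1 and §4] -/
theorem surfaceGroup_discriminated
    {n : ℕ} (hn : 2 ≤ n) (L : List (SurfaceGroup n)) (hL : ∀ x ∈ L, x ≠ 1) :
    ∃ Ψ : SurfaceGroup n →* FreeGroup Bool, ∀ x ∈ L, Ψ x ≠ 1 := by
  obtain ⟨k, rfl⟩ := Nat.exists_eq_add_of_le' hn
  obtain ⟨e, -⟩ := exists_surfaceGroup_mulEquiv_surfaceAmalgam (k + 1) 1
  obtain ⟨Ψ, hΨ⟩ := surfaceAmalgam_discriminated (Nat.le_add_left 1 k) (L.map e) (by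
    intro s hs
    obtain ⟨x, hx, rfl⟩ := List.mem_map.1 hs
    exact fun h0 => hL x hx (e.injective (h0.trans (map_one e).symm)))
  exact ⟨Ψ.comp e.toMonoidHom, fun x hx => hΨ (e x) (List.mem_map.2 ⟨x, hx, rfl⟩)⟩

/-- **Surface groups are residually free**: every `x ≠ 1` of `S_n`, `n ≥ 2`, survives in some
homomorphism `S_n → F₂`. [cite: Baumslag1962, §4] -/
theorem surfaceGroup_residuallyFree
    {n : ℕ} (hn : 2 ≤ n) (x : SurfaceGroup n) (hx : x ≠ 1) :
    ∃ Ψ : SurfaceGroup n →* FreeGroup Bool, Ψ x ≠ 1 := by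
  obtain ⟨Ψ, hΨ⟩ := surfaceGroup_discriminated hn [x] (by simpa using hx)
  exact ⟨Ψ, hΨ x (by simp)⟩

/-- **Non-commuting elements of a surface group stay non-commuting in some free quotient**: for
`x y ≠ y x` in `S_n`, `n ≥ 2`, there is `Ψ : S_n → F₂` with `Ψx Ψy ≠ Ψy Ψx`.
[cite: Baumslag1962, §4] -/
theorem surfaceGroup_exists_hom_mul_ne
    {n : ℕ} (hn : 2 ≤ n) (x y : SurfaceGroup n) (hxy : x * y ≠ y * x) :
    ∃ Ψ : SurfaceGroup n →* FreeGroup Bool, Ψ x * Ψ y ≠ Ψ y * Ψ x := by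
  obtain ⟨Ψ, hΨ⟩ := surfaceGroup_residuallyFree hn (x * y * x⁻¹ * y⁻¹) (by
    rwa [Ne, mul_inv_eq_one, mul_inv_eq_iff_eq_mul])
  refine ⟨Ψ, fun h => hΨ ?_⟩
  rw [map_mul, map_mul, map_mul, map_inv, map_inv, mul_inv_eq_one, mul_inv_eq_iff_eq_mul]
  exact h

end Literature.GroupTheory.CombinatorialGroupTheory
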